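/-
Origin: expansion seat `planner-pub-hodgecm-pohl-g13-0`, handover #7 2026-08-18T14:00:21Z (md5 c949714a924d126f26dc656762248c87, 267 l.; RUN 30 additive leaf; lands AFTER my #5 GaloisSpanBound (a6e9838a) (independent of #6); rewrite import Pohl13.GaloisSpanBound -> HodgeCM.Proofs.Pohlmann.GaloisSpanBound x1) (`HOME/pub-hodgecm-pohl-g13/lean/Pohl13/GaloisSpanGeneric.lean`, md5 c949714a, 267 lines);
landed by the gen-8 packager in gate run 30 as `HodgeCM/Proofs/Pohlmann/GaloisSpanGeneric.lean` (import ^import Pohl13\.GaloisSpanBound[ \t]*$→import HodgeCM.Proofs.Pohlmann.GaloisSpanBound ×1).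
-/
/-
Copyright: pub-hodgecm formalisation cell (harness21, 2026). New file (not vendored).
Origin: HOME/pub-hodgecm-pohl-g13/lean/Pohl13/GaloisSpanGeneric.lean — session planner-pub-hodgecm-pohl-g13-0 (unit pub-hodgecm-pohl-g13),
EXPANSION part (b) `PohlmannSpan`, generation 13, file 7.  Intended final place: `HodgeCM/Proofs/Pohlmann/GaloisSpanGeneric.lean`
(module `HodgeCM.Proofs.Pohlmann.GaloisSpanGeneric`).  ADDITIVE leaf.  WIP import `Pohl13.GaloisSpanBound`
= this seat's file 5 (rewrite to `import HodgeCM.Proofs.Pohlmann.GaloisSpanBound` on landing).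
-/
import Summits.HodgeConjecture.HodgeCM.Proofs.Pohlmann.GaloisSpanBound

/-!
# `[F̃:ℚ] ≤ 2^g · g!`, and a MAXIMAL Galois closure forces the naive Pohlmann span to HOLD

`Gal(F̃/ℚ)` (`F̃ = E^c`, `E = F¹`) acts faithfully on `Hom(F, ℂ)` commuting with complex conjugation, so an element
`σ` is determined by the permutation it induces on the `g` conjugate PAIRS together with the set of pairs it FLIPS.
Fixing a CM type `Θ` (one representative per pair) this is the injective CODE
`σ ↦ (pairPerm Θ σ, galStays Θ σ) ∈ Perm(Θ) × (Θ → Bool)` (`NonGalois.galCode_injective`).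

* `NonGalois.finrank_galoisClosure_le_two_pow_mul_factorial [IsCMField F] :
    finrank ℚ (galoisClosure (Fin (0 + 1) → F)) ≤ 2 ^ (finrank ℚ F / 2) * (finrank ℚ F / 2)!` — the Galois closure
  of a CM field of degree `2g` has degree at most `2^g · g!` (the order of the hyperoctahedral group `C₂ ≀ S_g`).
* `NonGalois.exists_galF_eq_swap_of_finrank_galoisClosure_eq` — if EQUALITY holds (the generic CM field:
  `Gal(F̃/ℚ) = C₂ ≀ S_g`), the code is a bijection, so some `σ` acts on `Hom(F, ℂ)` as a single sign change `t ↔ t̄`.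
* **`NonGalois.galSpanCondition_of_finrank_galoisClosure_eq (h : finrank ℚ (galoisClosure (Fin (0 + 1) → F)) =
    2 ^ (finrank ℚ F / 2) * (finrank ℚ F / 2)!) (m) : GalSpanCondition F m`** — by file 4's sign-change criterion
  `galSpanCondition_of_galF_eq_swap`; `NonGalois.indexSetsAgree_of_finrank_galoisClosure_eq`.
* **`Universe.naivePohlmannSpanAt_of_finrank_galoisClosure_eq`** — for a CM field with maximal Galois closure the
  naive (old-index-set) Pohlmann span holds for EVERY family of CM types at EVERY level (Galois or — for `g ≥ 2`,
  necessarily — not).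

Together with file 5 (`[F̃:ℚ] < 2g²` and `Aut(F/ℚ) = {1,c}` ⇒ FAILS) this brackets the naive span by the size
of the Galois closure: minimal-type closures fail, the maximal closure passes.

Nothing is posited; nothing is cited.
-/

noncomputable section

open scoped TensorProduct NumberField BigOperators
open NumberField NumberField.ComplexEmbedding

attribute [local instance] Classical.propDecidable

namespace HodgeCM

open Literature.AlgebraicGeometry.Motives (CMType HodgeStructure)
open HodgeCM.Pohlmann HodgeCM.GaoUllmo HodgeCM.CMTypeOps

namespace NonGalois

/-! ### Representatives of conjugate pairs in a CM type -/

section ToType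

variable {F : Type} [Field F] (Θ : CMType F)

/-- The representative in `Θ` of the conjugate pair `{u, ū}`. -/
def pairRep (u : F →+* ℂ) : ↥Θ.1 :=
  if h : u ∈ Θ.1 then ⟨u, h⟩ else ⟨conjugate u, (conjugate_mem_iff_notMem Θ u).mpr h⟩

/-- (Ported verbatim from the HodgeCMPerL package; no docstring in the source.) -/
theorem coe_pairRep_of_mem {u : F →+* ℂ} (h : u ∈ Θ.1) : (pairRep Θ u : F →+* ℂ) = u := by
  rw [pairRep, dif_pos h]

/-- (Ported verbatim from the HodgeCMPerL package; no docstring in the source.) -/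
theorem coe_pairRep_of_not_mem {u : F →+* ℂ} (h : u ∉ Θ.1) : (pairRep Θ u : F →+* ℂ) = conjugate u := by
  rw [pairRep, dif_neg h]

/-- (Ported verbatim from the HodgeCMPerL package; no docstring in the source.) -/
theorem coe_pairRep_eq_or (u : F →+* ℂ) : (pairRep Θ u : F →+* ℂ) = u ∨ (pairRep Θ u : F →+* ℂ) = conjugate u := by
  by_cases h : u ∈ Θ.1
  · exact Or.inl (coe_pairRep_of_mem Θ h)
  · exact Or.inr (coe_pairRep_of_not_mem Θ h)

/-- (Ported verbatim from the HodgeCMPerL package; no docstring in the source.) -/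
theorem pairRep_conjugate (u : F →+* ℂ) : pairRep Θ (conjugate u) = pairRep Θ u := by
  apply Subtype.ext
  by_cases h : u ∈ Θ.1
  · have h' : conjugate u ∉ Θ.1 := (mem_iff_conjugate_notMem Θ u).mp h
    rw [coe_pairRep_of_not_mem Θ h', coe_pairRep_of_mem Θ h, involutive_conjugate]
  · have h' : conjugate u ∈ Θ.1 := (conjugate_mem_iff_notMem Θ u).mpr h
    rw [coe_pairRep_of_mem Θ h', coe_pairRep_of_not_mem Θ h]

/-- (Ported verbatim from the HodgeCMPerL package; no docstring in the source.) -/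
theorem pairRep_coe (t : ↥Θ.1) : pairRep Θ (t : F →+* ℂ) = t :=
  Subtype.ext (coe_pairRep_of_mem Θ t.2)

/-- Two embeddings with the same representative are equal or conjugate. -/
theorem eq_or_eq_conjugate_of_pairRep_eq {u v : F →+* ℂ} (h : pairRep Θ u = pairRep Θ v) : u = v ∨ u = conjugate v := by
  have hu := coe_pairRep_eq_or Θ u
  have hv := coe_pairRep_eq_or Θ v
  rw [h] at hu
  rcases hu with hu | hu <;> rcases hv with hv | hv
  · exact Or.inl (hu.symm.trans hv)
  · exact Or.inr (hu.symm.trans hv)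
  · right
    have h1 := congrArg conjugate (hu.symm.trans hv)
    rwa [(involutive_conjugate F) u] at h1
  · left
    have h1 := congrArg conjugate (hu.symm.trans hv)
    rwa [(involutive_conjugate F) u, (involutive_conjugate F) v] at h1

end ToType

/-! ### Coding `Gal(F̃/ℚ)` by (permutation of pairs, set of flipped pairs) -/

section Code

variable {F : Type} [Field F] [NumberField F]

/-- (Ported verbatim from the HodgeCMPerL package; no docstring in the source.) -/
theorem card_coe_type (Θ : CMType F) : Fintype.card ↥Θ.1 = Module.finrank ℚ F / 2 := by
  rw [← Nat.card_eq_fintype_card, Nat.card_coe_set_eq, ncard_type_eq]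

/-- (Ported verbatim from the HodgeCMPerL package; no docstring in the source.) -/
theorem card_galCode_target (Θ : CMType F) :
    Fintype.card (Equiv.Perm ↥Θ.1 × (↥Θ.1 → Bool)) = 2 ^ (Module.finrank ℚ F / 2) * (Module.finrank ℚ F / 2).factorial := by
  rw [Fintype.card_prod, Fintype.card_perm, Fintype.card_fun, Fintype.card_bool, card_coe_type, mul_comm]

/-- Faithfulness: `σ` is determined by its action on `Hom(F, ℂ)` (file 4's `galF_eq_id_iff`). -/
theorem eq_of_galF_eq {n : ℕ} {σ τ : galoisClosure (Fin (n + 1) → F) ≃ₐ[ℚ] galoisClosure (Fin (n + 1) → F)}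
    (h : galF n σ = galF n τ) : σ = τ := by
  have h1 : galF n (τ⁻¹ * σ) = id := funext fun s => by
    rw [galF_mul, congr_fun h s, ← galF_mul, inv_mul_cancel, galF_one, id]
  have h2 : τ⁻¹ * σ = 1 := galF_eq_id_iff.mp h1
  exact (inv_mul_eq_one.mp h2).symm

variable [IsCMField F] (Θ : CMType F)

/-- The permutation of `Θ` (≃ conjugate pairs) induced by `σ`, as a function. -/
def pairPermFun (σ : galoisClosure (Fin (0 + 1) → F) ≃ₐ[ℚ] galoisClosure (Fin (0 + 1) → F)) (t : ↥Θ.1) : ↥Θ.1 :=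
  pairRep Θ (galF 0 σ t)

/-- (Ported verbatim from the HodgeCMPerL package; no docstring in the source.) -/
theorem pairPermFun_injective (σ : galoisClosure (Fin (0 + 1) → F) ≃ₐ[ℚ] galoisClosure (Fin (0 + 1) → F)) :
    Function.Injective (pairPermFun Θ σ) := by
  intro t t' h
  rcases eq_or_eq_conjugate_of_pairRep_eq Θ h with h1 | h1
  · exact Subtype.ext (galF_injective σ h1)
  · exfalso
    rw [← isBarCommuting_galF σ] at h1
    have h2 : (t : F →+* ℂ) = conjugate (t' : F →+* ℂ) := galF_injective σ h1
    have h3 : conjugate (t' : F →+* ℂ) ∉ Θ.1 := (mem_iff_conjugate_notMem Θ _).mp t'.2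
    exact h3 (h2 ▸ t.2)

/-- The permutation of `Θ` (≃ conjugate pairs) induced by `σ`. -/
def pairPerm (σ : galoisClosure (Fin (0 + 1) → F) ≃ₐ[ℚ] galoisClosure (Fin (0 + 1) → F)) : Equiv.Perm ↥Θ.1 :=
  Equiv.ofBijective (pairPermFun Θ σ) (Finite.injective_iff_bijective.mp (pairPermFun_injective Θ σ))

/-- (Ported verbatim from the HodgeCMPerL package; no docstring in the source.) -/
theorem pairPerm_apply (σ : galoisClosure (Fin (0 + 1) → F) ≃ₐ[ℚ] galoisClosure (Fin (0 + 1) → F)) (t : ↥Θ.1) :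
    pairPerm Θ σ t = pairRep Θ (galF 0 σ t) := rfl

/-- Which representatives STAY in `Θ` under `σ` (the complement is the set of flipped pairs). -/
def galStays (σ : galoisClosure (Fin (0 + 1) → F) ≃ₐ[ℚ] galoisClosure (Fin (0 + 1) → F)) (t : ↥Θ.1) : Bool :=
  decide (galF 0 σ t ∈ Θ.1)

/-- The code of `σ`. -/
def galCode (σ : galoisClosure (Fin (0 + 1) → F) ≃ₐ[ℚ] galoisClosure (Fin (0 + 1) → F)) : Equiv.Perm ↥Θ.1 × (↥Θ.1 → Bool) :=
  (pairPerm Θ σ, galStays Θ σ)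

/-- `σ u` (`u ∈ Θ`) is recovered from the code: the representative, conjugated iff the pair is flipped. -/
theorem galF_eq_of_galCode (σ : galoisClosure (Fin (0 + 1) → F) ≃ₐ[ℚ] galoisClosure (Fin (0 + 1) → F)) {u : F →+* ℂ} (hu : u ∈ Θ.1) :
    galF 0 σ u = if galStays Θ σ ⟨u, hu⟩ then ((pairPerm Θ σ ⟨u, hu⟩ : ↥Θ.1) : F →+* ℂ)
      else conjugate ((pairPerm Θ σ ⟨u, hu⟩ : ↥Θ.1) : F →+* ℂ) := by
  show galF 0 σ u = if decide (galF 0 σ u ∈ Θ.1) then (pairRep Θ (galF 0 σ u) : F →+* ℂ)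
    else conjugate (pairRep Θ (galF 0 σ u) : F →+* ℂ)
  by_cases h : galF 0 σ u ∈ Θ.1
  · rw [decide_eq_true h, if_pos rfl, coe_pairRep_of_mem Θ h]
  · rw [decide_eq_false h, coe_pairRep_of_not_mem Θ h, involutive_conjugate]
    exact (if_neg Bool.false_ne_true).symm

/-- **The code is injective**: `Gal(F̃/ℚ) ↪ Perm(pairs) × 2^{pairs}`. -/
theorem galCode_injective : Function.Injective (galCode Θ) := by
  intro σ τ h
  have hp : pairPerm Θ σ = pairPerm Θ τ := congrArg Prod.fst h
  have hs : galStays Θ σ = galStays Θ τ := congrArg Prod.snd h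
  have hΘ : ∀ (u : F →+* ℂ) (hu : u ∈ Θ.1), galF 0 σ u = galF 0 τ u := fun u hu => by
    rw [galF_eq_of_galCode Θ σ hu, galF_eq_of_galCode Θ τ hu, hp, hs]
  refine eq_of_galF_eq (funext fun u => ?_)
  by_cases hu : u ∈ Θ.1
  · exact hΘ u hu
  · have h1 := hΘ (conjugate u) ((conjugate_mem_iff_notMem Θ u).mpr hu)
    rw [isBarCommuting_galF σ u, isBarCommuting_galF τ u] at h1
    exact (involutive_conjugate F).injective h1

/-- **`[F̃ : ℚ] ≤ 2^g · g!`** for a CM field of degree `2g` (`F̃` = the Galois closure, `g = [F:ℚ]/2`). -/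
theorem finrank_galoisClosure_le_two_pow_mul_factorial :
    Module.finrank ℚ (galoisClosure (Fin (0 + 1) → F)) ≤ 2 ^ (Module.finrank ℚ F / 2) * (Module.finrank ℚ F / 2).factorial := by
  rw [← IsGalois.card_aut_eq_finrank, Nat.card_eq_fintype_card, ← card_galCode_target (placesType F)]
  exact Fintype.card_le_of_injective _ (galCode_injective (placesType F))

/-- With a MAXIMAL Galois closure the code is onto: every (permutation, flip set) is realised. -/
theorem galCode_surjective_of_finrank_eq
    (h : Module.finrank ℚ (galoisClosure (Fin (0 + 1) → F)) = 2 ^ (Module.finrank ℚ F / 2) * (Module.finrank ℚ F / 2).factorial) :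
    Function.Surjective (galCode Θ) := by
  have hc : Fintype.card (galoisClosure (Fin (0 + 1) → F) ≃ₐ[ℚ] galoisClosure (Fin (0 + 1) → F)) =
      Fintype.card (Equiv.Perm ↥Θ.1 × (↥Θ.1 → Bool)) := by
    rw [card_galCode_target, ← h, ← IsGalois.card_aut_eq_finrank, Nat.card_eq_fintype_card]
  exact ((Fintype.bijective_iff_injective_and_card _).mpr ⟨galCode_injective Θ, hc⟩).2

/-- **Maximal closure ⇒ a single sign change.**  If `[F̃:ℚ] = 2^g · g!`, some `σ ∈ Gal(F̃/ℚ)` acts on `Hom(F, ℂ)` as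
the transposition `t₀ ↔ t̄₀`. -/
theorem exists_galF_eq_swap_of_finrank_galoisClosure_eq
    (h : Module.finrank ℚ (galoisClosure (Fin (0 + 1) → F)) = 2 ^ (Module.finrank ℚ F / 2) * (Module.finrank ℚ F / 2).factorial)
    (t₀ : F →+* ℂ) (ht₀ : t₀ ∈ Θ.1) :
    ∃ σ : galoisClosure (Fin (0 + 1) → F) ≃ₐ[ℚ] galoisClosure (Fin (0 + 1) → F), galF 0 σ = Equiv.swap t₀ (conjugate t₀) := by
  obtain ⟨σ, hσ⟩ := galCode_surjective_of_finrank_eq Θ h (1, fun t : ↥Θ.1 => decide ((t : F →+* ℂ) ≠ t₀))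
  have hp : pairPerm Θ σ = 1 := congrArg Prod.fst hσ
  have hs : galStays Θ σ = fun t : ↥Θ.1 => decide ((t : F →+* ℂ) ≠ t₀) := congrArg Prod.snd hσ
  -- values on `Θ`: `t₀ ↦ t̄₀`, the other representatives are fixed
  have hΘ : ∀ (u : F →+* ℂ) (hu : u ∈ Θ.1), galF 0 σ u = if u = t₀ then conjugate u else u := fun u hu => by
    rw [galF_eq_of_galCode Θ σ hu, hp, hs, Equiv.Perm.one_apply]
    by_cases hut : u = t₀
    · have hd : (fun t : ↥Θ.1 => decide ((t : F →+* ℂ) ≠ t₀)) ⟨u, hu⟩ = false := by simp [hut]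
      rw [hd, if_pos hut, if_neg Bool.false_ne_true]
    · have hd : (fun t : ↥Θ.1 => decide ((t : F →+* ℂ) ≠ t₀)) ⟨u, hu⟩ = true := by simp [hut]
      rw [hd, if_neg hut, if_pos rfl]
  have ht₀' : conjugate t₀ ∉ Θ.1 := (mem_iff_conjugate_notMem Θ t₀).mp ht₀
  refine ⟨σ, funext fun u => ?_⟩
  by_cases hu : u ∈ Θ.1
  · rw [hΘ u hu]
    by_cases hut : u = t₀
    · rw [if_pos hut, hut, Equiv.swap_apply_left]
    · have hne : u ≠ conjugate t₀ := fun h' => ht₀' (h' ▸ hu)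
      rw [if_neg hut, Equiv.swap_apply_of_ne_of_ne hut hne]
  · have h1 := hΘ (conjugate u) ((conjugate_mem_iff_notMem Θ u).mpr hu)
    rw [isBarCommuting_galF σ u] at h1
    have hut : u ≠ t₀ := fun h' => hu (h' ▸ ht₀)
    by_cases huc : conjugate u = t₀
    · rw [if_pos huc] at h1
      have hu' : u = conjugate t₀ := by rw [← huc, involutive_conjugate]
      rw [(involutive_conjugate F).injective h1, hu', Equiv.swap_apply_right]
      exact involutive_conjugate F t₀
    · rw [if_neg huc] at h1
      have hne : u ≠ conjugate t₀ := fun h' => huc (by rw [h', involutive_conjugate])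
      rw [Equiv.swap_apply_of_ne_of_ne hut hne]
      exact (involutive_conjugate F).injective h1

/-- **Theorem (generic CM fields PASS).**  If the Galois closure of the CM field `F` (degree `2g`) has the maximal
degree `2^g · g!`, the Galois span condition `LIN(F)` holds at every level. -/
theorem galSpanCondition_of_finrank_galoisClosure_eq
    (h : Module.finrank ℚ (galoisClosure (Fin (0 + 1) → F)) = 2 ^ (Module.finrank ℚ F / 2) * (Module.finrank ℚ F / 2).factorial)
    (m : ℕ) : GalSpanCondition F m := by
  obtain ⟨t₀⟩ : Nonempty (F →+* ℂ) := inferInstance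
  obtain ⟨σ, hσ⟩ := exists_galF_eq_swap_of_finrank_galoisClosure_eq (typeThrough t₀) h t₀ (mem_typeThrough t₀)
  exact galSpanCondition_of_galF_eq_swap hσ m

/-- (Ported verbatim from the HodgeCMPerL package; no docstring in the source.) -/
theorem indexSetsAgree_of_finrank_galoisClosure_eq
    (h : Module.finrank ℚ (galoisClosure (Fin (0 + 1) → F)) = 2 ^ (Module.finrank ℚ F / 2) * (Module.finrank ℚ F / 2).factorial)
    {m : ℕ} (Θ : Fin (m + 1) → CMType F) (p : ℕ) : IndexSetsAgree Θ p :=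
  indexSetsAgree_of_galSpanCondition (galSpanCondition_of_finrank_galoisClosure_eq h m) Θ p

end Code

end NonGalois

/-! ### Consequence for the naive Pohlmann span -/

namespace Universe

open NonGalois

variable {U : Universe}

/-- **Generic CM fields satisfy the naive Pohlmann span.**  If `[F̃:ℚ] = 2^g · g!` (`Gal(F̃/ℚ)` is the full
hyperoctahedral group `C₂ ≀ S_g` — for `g ≥ 2` such `F` is NOT Galois), then for every family `Θ` of CM types of
`F` the Hodge classes of `A_Θ` are spanned over `ℂ` by the weight vectors of the OLD index set `IsHodgeWeight Θ p`. -/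
theorem naivePohlmannSpanAt_of_finrank_galoisClosure_eq (M : U.ModelAxioms) (hN1 : U.Fact_cupExterior)
    (hN2 : U.Fact_cup_hodge) (hN3 : U.Fact_pull_H0) (F : CMField)
    (h : Module.finrank ℚ (galoisClosure (Fin (0 + 1) → (F : Type))) = 2 ^ F.halfDegree * F.halfDegree.factorial)
    {n : ℕ} (Θ : Fin (n + 1) → CMType F) (p : ℕ) : U.NaivePohlmannSpanAt F Θ p :=
  naivePohlmannSpanAt_of_galSpanCondition M hN1 hN2 hN3 (galSpanCondition_of_finrank_galoisClosure_eq h n) Θ p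

end Universe

end HodgeCM
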